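import Summits.ResolutionOfSingularities.ResolutionOfSingularities.Theorems.RegularCurveDepth
import HarnessLib

/-!
# RegularCurveDepthRel — tree file 2/6: §9 (continued) the depth filtration RELATIVE to a transversal parameter
`s` with `𝔪 = (s) + P`,
`P = (w₁, …, w_r)`, and the one-round depth law `depth_point_law`.  PROVED, universe-generic.

Content VERBATIM from the decomp-res lens-6 g17 file
`HOME/decomp-res-lens-6/g17/parts/RegularCurveLaw-REV1-5548be76.lean` (sha256 5548be7624d15d37;
CRITIC-LEDGER row 128; critic landing order 2026-08-30T18:16:59Z).  Its §0–§8 are g16 `AbsoluteGiraud.lean`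
@bc25b587 byte-identical and ALREADY in
the tree as `Theorems/AbsoluteContact{Scope,Primitives,HasseRing,Hasse,Axes}` + `AbsoluteGiraud{Kernel,Branch}`;
only §9–§13 are landed here — §11–§13 in the text of the lens's rev 2 TREE-SYNC pin
`parts/RegularCurveLaw-REV2-fe4ab852.lean`
(code byte-identical to rev 1; five docstrings sharpened for the critic's hygiene asks h1/h2/h4, STATUS 18:31:35Z).
HOME = run/shared/lean/pub/decomp-res.  Host: route `MaxContactCut`, asides AGHypHug3Insep 27753 / AGAbsContactOff3
27752 / AGAllHug3Off3 27751
(refining 31574 `PVPureGame`).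

[WRITER NOTE (decomp-res writer g6): the critic asked for Literature/…/Resolution placement of the scheme-level
kernels §9/§10; they land
Summits-side because the Literature gate accepts only [cite:]-tagged PUBLISHED statements (same ruling as `CouplingCutCoupled` /
`AbsoluteGiraudKernel`).  ONE namespace `…Theorems.AbsoluteContactClasses` as in the lens; global `set_option`
lines dropped (scoped
`set_option maxHeartbeats … in` kept); nothing else changed.]
(Sources: Giraud1975; EncinasVillamayor2000 Thm. 4.9; BravoGarciaEscamillaVillamayor2012 Lemma 4.6;
VillamayorU2008ReesDiff §4; CossartPiltant2008 §2; CossartJannsenSaito2020 §2–§3; EGAIV4 §16–§17;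
Matsumura1986 §14–§17.)
-/

noncomputable section

open CategoryTheory AlgebraicGeometry TopologicalSpace
open Literature.AlgebraicGeometry.Resolution
open Summit.ResolutionOfSingularities.ResolutionOfSingularities.Theorems
open WeakOrderReduction ForcedTowerClasses PurityValveClasses
open SatelliteExitClasses
open IsLocalRing MvPolynomial

namespace Summit.ResolutionOfSingularities.ResolutionOfSingularities.Theorems.AbsoluteContactClasses

universe uD
section DepthAlgebra

variable {R : Type uD} [CommRing R]
variable [IsLocalRing R]

/-! ### Relative to a transversal parameter `s`: `𝔪 = (s) + P`, `P = (w₁, …, w_r)` -/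

variable {r : ℕ} {s : R} {w : Fin r → R}

omit [CommRing R] [IsLocalRing R] in
/-- `cons_comp_succ`: Auxiliary step of this node's calculus, VERBATIM from the lens file (see the module docstring); the statement is its type. [folklore] -/
theorem cons_comp_succ (s : R) (w : Fin r → R) :
    (Fin.cons s w : Fin (r + 1) → R) ∘ Fin.succ = w :=
  _root_.funext fun j => by simp

/-- `maximalIdeal_eq_span_sup`: Auxiliary step of this node's calculus, VERBATIM from the lens file (see the module docstring); the statement is its type. [folklore] -/
theorem maximalIdeal_eq_span_sup (hfull : Ideal.span (Set.range (Fin.cons s w)) = maximalIdeal R) :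
    maximalIdeal R = Ideal.span {s} ⊔ Ideal.span (Set.range w) := by
  rw [← hfull, Fin.range_cons, Ideal.span_insert]

/-- `maximalIdeal_pow_le`: Auxiliary step of this node's calculus, VERBATIM from the lens file (see the module docstring); the statement is its type. [folklore] -/
theorem maximalIdeal_pow_le (hfull : Ideal.span (Set.range (Fin.cons s w)) = maximalIdeal R)
    {n a b : ℕ} (h : a + b ≤ n + 1) :
    maximalIdeal R ^ n ≤ Ideal.span {s ^ a} ⊔ Ideal.span (Set.range w) ^ b := by
  rw [maximalIdeal_eq_span_sup hfull, ← Ideal.span_singleton_pow]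
  exact sup_pow_le_pow_sup_pow _ _ n a b h

/-- `s_mem_maximalIdeal`: Auxiliary step of this node's calculus, VERBATIM from the lens file (see the module docstring); the statement is its type. [folklore] -/
theorem s_mem_maximalIdeal (hsw : IsRsopPart (Fin.cons s w)) : s ∈ maximalIdeal R := by
  simpa using hsw.mem_maximalIdeal 0

/-- `span_range_le_maximalIdeal`: Auxiliary step of this node's calculus, VERBATIM from the lens file (see the module docstring); the statement is its type. [folklore] -/
theorem span_range_le_maximalIdeal (hsw : IsRsopPart (Fin.cons s w)) :
    Ideal.span (Set.range w) ≤ maximalIdeal R :=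
  Ideal.span_le.mpr (by rintro _ ⟨j, rfl⟩; simpa using hsw.mem_maximalIdeal j.succ)

/-- `isRsopPart_tail`: Auxiliary step of this node's calculus, VERBATIM from the lens file (see the module docstring); the statement is its type. [folklore] -/
theorem isRsopPart_tail (hsw : IsRsopPart (Fin.cons s w)) : IsRsopPart w := by
  have := hsw.comp Fin.succ (Fin.succ_injective _)
  rwa [cons_comp_succ] at this

/-- `(s)`-colon: `s * y ∈ P ^ k → y ∈ P ^ k`. [folklore] -/
theorem mem_pow_of_mul_mem (hsw : IsRsopPart (Fin.cons s w)) (k : ℕ) {y : R}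
    (h : s * y ∈ Ideal.span (Set.range w) ^ k) : y ∈ Ideal.span (Set.range w) ^ k := by
  have h0 : (0 : Fin (r + 1)) ∉ Set.range (Fin.succ : Fin r → Fin (r + 1)) := by
    rintro ⟨j, hj⟩; exact Fin.succ_ne_zero j hj
  have := hsw.mem_pow_span_range_comp_of_mul_mem Fin.succ h0 k (y := y)
    (by rw [cons_comp_succ]; simpa using h)
  rwa [cons_comp_succ] at this

/-- `mem_pow_of_pow_mul_mem`: Auxiliary step of this node's calculus, VERBATIM from the lens file (see the module docstring); the statement is its type. [folklore] -/
theorem mem_pow_of_pow_mul_mem (hsw : IsRsopPart (Fin.cons s w)) (j k : ℕ) {y : R}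
    (h : s ^ j * y ∈ Ideal.span (Set.range w) ^ k) : y ∈ Ideal.span (Set.range w) ^ k := by
  induction j with
  | zero => simpa using h
  | succ j ih =>
    apply ih
    apply mem_pow_of_mul_mem hsw k
    rw [← mul_assoc, ← pow_succ']
    exact h

/-- A part of a regular system of parameters is quasi-regular. (Sources: Matsumura1987, Thm. 16.2.) -/
theorem isQuasiRegular_of_isRsopPart {n : ℕ} {z : Fin n → R} (hz : IsRsopPart z) :
    IsQuasiRegular z := by
  haveI := hz.isRegularLocalRing
  obtain ⟨e, x, hd, hx, hxz⟩ := hz.exists_rsop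
  have : z = x ∘ Fin.castAdd e := _root_.funext fun i => (hxz i).symm
  rw [this]
  exact isQuasiRegular_rsop_comp hd x hx _ (Fin.castAdd_injective n e)

/-- `maximalIdeal_mul_pow_le`: Auxiliary step of this node's calculus, VERBATIM from the lens file (see the module docstring); the statement is its type. [folklore] -/
theorem maximalIdeal_mul_pow_le (hfull : Ideal.span (Set.range (Fin.cons s w)) = maximalIdeal R)
    (c : ℕ) :
    maximalIdeal R * Ideal.span (Set.range w) ^ c ⊔ Ideal.span (Set.range w) ^ (c + 1) ≤
      Ideal.span {s} * Ideal.span (Set.range w) ^ c ⊔ Ideal.span (Set.range w) ^ (c + 1) := by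
  refine sup_le ?_ le_sup_right
  rw [maximalIdeal_eq_span_sup hfull, Ideal.sup_mul, ← pow_succ']

/-- `depthIdeal_le_span_pow_mul`: Auxiliary step of this node's calculus, VERBATIM from the lens file (see the module docstring); the statement is its type. [folklore] -/
theorem depthIdeal_le_span_pow_mul (hfull : Ideal.span (Set.range (Fin.cons s w)) = maximalIdeal R)
    (c ν : ℕ) :
    depthIdeal (Ideal.span (Set.range w)) c ν ≤
      Ideal.span {s ^ ν} * Ideal.span (Set.range w) ^ c ⊔ Ideal.span (Set.range w) ^ (c + 1) := by
  refine sup_le ?_ le_sup_right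
  calc maximalIdeal R ^ ν * Ideal.span (Set.range w) ^ c
      ≤ (Ideal.span {s ^ ν} ⊔ Ideal.span (Set.range w) ^ 1) * Ideal.span (Set.range w) ^ c :=
        Ideal.mul_mono_left (maximalIdeal_pow_le hfull (by omega))
    _ = Ideal.span {s ^ ν} * Ideal.span (Set.range w) ^ c ⊔ Ideal.span (Set.range w) ^ (c + 1) := by
        rw [Ideal.sup_mul, pow_one, ← pow_succ']

/-- **`Q`-core law**: an element of `P ^ c` of `𝔪`-adic order `≥ b > c` has depth `≥ b - c`.
[folklore] -/
theorem mem_depthIdeal_of_mem_pow (hsw : IsRsopPart (Fin.cons s w))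
    (hfull : Ideal.span (Set.range (Fin.cons s w)) = maximalIdeal R) {b c : ℕ} (hcb : c < b)
    {f : R} (hfm : f ∈ maximalIdeal R ^ b) (hfP : f ∈ Ideal.span (Set.range w) ^ c) :
    f ∈ depthIdeal (Ideal.span (Set.range w)) c (b - c) := by
  set P := Ideal.span (Set.range w)
  have h1 : f ∈ Ideal.span {s ^ (b - c)} ⊔ P ^ (c + 1) :=
    maximalIdeal_pow_le hfull (by omega) hfm
  obtain ⟨g1, hg1, h, hh, hgh⟩ := Submodule.mem_sup.mp h1
  obtain ⟨g, rfl⟩ := Ideal.mem_span_singleton'.mp hg1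
  have hg : s ^ (b - c) * g ∈ P ^ c := by
    have : s ^ (b - c) * g = f - h := by rw [← hgh]; ring
    rw [this]
    exact sub_mem hfP (Ideal.pow_le_pow_right (Nat.le_succ c) hh)
  have hg' : g ∈ P ^ c := mem_pow_of_pow_mul_mem hsw (b - c) c hg
  rw [← hgh]
  refine Submodule.mem_sup.mpr ⟨s ^ (b - c) * g,
    Ideal.mul_mem_mul (Ideal.pow_mem_pow (s_mem_maximalIdeal hsw) _) hg', h, hh, by ring⟩

/-- **Decomposition at exact depth `ν`**: `f = s ^ ν g + h` with `g ∈ P ^ c` of unit leading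
form modulo `𝔪 P ^ c + P ^ (c+1)`, `h ∈ P ^ (c+1)`. [folklore] -/
theorem exists_decomp_of_mem_depthIdeal (hsw : IsRsopPart (Fin.cons s w))
    (hfull : Ideal.span (Set.range (Fin.cons s w)) = maximalIdeal R) {c ν : ℕ} {f : R}
    (hmem : f ∈ depthIdeal (Ideal.span (Set.range w)) c ν)
    (hnot : f ∉ depthIdeal (Ideal.span (Set.range w)) c (ν + 1)) :
    ∃ g h : R, g ∈ Ideal.span (Set.range w) ^ c ∧ h ∈ Ideal.span (Set.range w) ^ (c + 1) ∧
      f = s ^ ν * g + h ∧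
      g ∉ maximalIdeal R * Ideal.span (Set.range w) ^ c ⊔ Ideal.span (Set.range w) ^ (c + 1) := by
  set P := Ideal.span (Set.range w)
  obtain ⟨a, ha, h, hh, hah⟩ := Submodule.mem_sup.mp (depthIdeal_le_span_pow_mul hfull c ν hmem)
  obtain ⟨g, hg, rfl⟩ := Ideal.mem_span_singleton_mul.mp ha
  refine ⟨g, h, hg, hh, hah.symm, fun hgm => hnot ?_⟩
  obtain ⟨a1, ha1, g3, hg3, hag⟩ := Submodule.mem_sup.mp (maximalIdeal_mul_pow_le hfull c hgm)
  obtain ⟨q, hq, rfl⟩ := Ideal.mem_span_singleton_mul.mp ha1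
  have hf : f = s ^ (ν + 1) * q + (s ^ ν * g3 + h) := by
    rw [← hah, ← hag]; ring
  rw [hf]
  refine Submodule.mem_sup.mpr ⟨s ^ (ν + 1) * q, ?_, s ^ ν * g3 + h, ?_, rfl⟩
  · exact Ideal.mul_mem_mul (Ideal.pow_mem_pow (s_mem_maximalIdeal hsw) _) hq
  · exact add_mem (Ideal.mul_mem_left _ _ hg3) hh

/-- **Unit-coefficient test** (quasi-regularity): a degree-`c` form `G` with `G(w) ∈ 𝔪 P ^ c +
P ^ (c+1)` has all its coefficients in `𝔪`. (Sources: Matsumura1987, Thm. 16.2.) -/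
theorem coeff_mem_maximalIdeal_of_eval_mem (hsw : IsRsopPart (Fin.cons s w))
    (hfull : Ideal.span (Set.range (Fin.cons s w)) = maximalIdeal R) {c : ℕ}
    {G : MvPolynomial (Fin r) R} (hG : G.IsHomogeneous c)
    (h : MvPolynomial.eval w G ∈
      maximalIdeal R * Ideal.span (Set.range w) ^ c ⊔ Ideal.span (Set.range w) ^ (c + 1)) :
    ∀ m, G.coeff m ∈ maximalIdeal R := by
  classical
  set P := Ideal.span (Set.range w)
  obtain ⟨a, ha, h2, hh2, hah⟩ := Submodule.mem_sup.mp (maximalIdeal_mul_pow_le hfull c h)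
  obtain ⟨q, hq, rfl⟩ := Ideal.mem_span_singleton_mul.mp ha
  obtain ⟨Q, hQ, rfl⟩ := exists_isHomogeneous_of_mem_span_pow w c hq
  have hqr : IsQuasiRegular w := isQuasiRegular_of_isRsopPart (isRsopPart_tail hsw)
  have hev : MvPolynomial.eval w (G - C s * Q) ∈ P ^ (c + 1) := by
    rw [map_sub, map_mul, MvPolynomial.eval_C, ← hah]
    simpa using hh2
  have hco := (isQuasiRegular_def w).mp hqr c (G - C s * Q) (hG.sub (hQ.C_mul s)) hev
  intro m
  have hm := hco m
  rw [MvPolynomial.coeff_sub, MvPolynomial.coeff_C_mul] at hm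
  have : G.coeff m = (G.coeff m - s * Q.coeff m) + s * Q.coeff m := by ring
  rw [this]
  exact add_mem (span_range_le_maximalIdeal hsw hm)
    (Ideal.mul_mem_right _ _ (s_mem_maximalIdeal hsw))

/-- **Point law for the depth filtration** (ring level). Along a local homomorphism `σ : R → S`
of regular local rings with full regular systems `(s, w)` of `R` and `(t, w')` of `S` such that
`σ s = t`, `σ wⱼ = t · w'ⱼ` (the transversal chart of the blow-up of the closed point along the
curve `P = (w)`), an element `f` of exact depth `ν ≥ b - c` (`c < b`) with `σ f = t ^ b · f'`
has a controlled transform `f'` of exact depth `ν - (b - c)`. [folklore; cf. the classical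
"order of the restriction to the curve drops by `b - c`"] [folklore] -/
theorem depth_point_law {S : Type*} [CommRing S] [IsLocalRing S] (σ : R →+* S) [IsLocalHom σ]
    (hsw : IsRsopPart (Fin.cons s w))
    (hfull : Ideal.span (Set.range (Fin.cons s w)) = maximalIdeal R)
    {t : S} {w' : Fin r → S} (htw : IsRsopPart (Fin.cons t w'))
    (hfull' : Ideal.span (Set.range (Fin.cons t w')) = maximalIdeal S)
    (hst : σ s = t) (hww : ∀ j, σ (w j) = t * w' j) (ht : t ∈ nonZeroDivisors S)
    {b c ν : ℕ} (hcb : c < b) (hν : b - c ≤ ν) {f : R} {f' : S} (hff : σ f = t ^ b * f')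
    (hmem : f ∈ depthIdeal (Ideal.span (Set.range w)) c ν)
    (hnot : f ∉ depthIdeal (Ideal.span (Set.range w)) c (ν + 1)) :
    f' ∈ depthIdeal (Ideal.span (Set.range w')) c (ν - (b - c)) ∧
      f' ∉ depthIdeal (Ideal.span (Set.range w')) c (ν - (b - c) + 1) := by
  classical
  set P := Ideal.span (Set.range w)
  set P' := Ideal.span (Set.range w')
  obtain ⟨g, h, hg, hh, hf, hgm⟩ := exists_decomp_of_mem_depthIdeal hsw hfull hmem hnot
  obtain ⟨G, hG, rfl⟩ := exists_isHomogeneous_of_mem_span_pow w c hg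
  obtain ⟨H, hH, rfl⟩ := exists_isHomogeneous_of_mem_span_pow w (c + 1) hh
  -- a coefficient of `G` is a unit
  obtain ⟨m₀, hm₀⟩ : ∃ m, G.coeff m ∉ maximalIdeal R := by
    by_contra hall
    push Not at hall
    exact hgm (Submodule.mem_sup_left
      (eval_mem_mul_span_pow w hG ((mem_map_C_iff (I := maximalIdeal R)).mpr hall)))
  have hσw : σ ∘ w = t • w' := _root_.funext fun j => by simp [hww]
  -- transforms of the two forms
  set g' : S := MvPolynomial.eval w' (MvPolynomial.map σ G) with hg'
  set h' : S := MvPolynomial.eval w' (MvPolynomial.map σ H) with hh'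
  have hg'P : g' ∈ P' ^ c := eval_mem_span_pow w' (hG.map σ)
  have hh'P : h' ∈ P' ^ (c + 1) := eval_mem_span_pow w' (hH.map σ)
  have hσg : σ (MvPolynomial.eval w G) = t ^ c * g' := by
    rw [ringHom_eval, hσw, eval_smul_eq_pow_mul (hG.map σ)]
  have hσh : σ (MvPolynomial.eval w H) = t ^ (c + 1) * h' := by
    rw [ringHom_eval, hσw, eval_smul_eq_pow_mul (hH.map σ)]
  -- the exponent bookkeeping: `ν = ν' + (b - c)`, `b = c + d + 1`
  obtain ⟨d, rfl⟩ : ∃ d, b = c + d + 1 := ⟨b - c - 1, by omega⟩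
  obtain ⟨ν', rfl⟩ : ∃ ν', ν = ν' + (d + 1) := ⟨ν - (d + 1), by omega⟩
  have hbc : c + d + 1 - c = d + 1 := by omega
  rw [hbc, Nat.add_sub_cancel]
  -- `t ^ (c+1) · (t ^ d (f' - t^ν' g')) = t ^ (c+1) · h'`
  have hkey : t ^ d * (f' - t ^ ν' * g') = h' := by
    have hpow : t ^ (c + 1) ∈ nonZeroDivisors S := pow_mem ht _
    have h1 : t ^ (c + 1) * (t ^ d * (f' - t ^ ν' * g')) = t ^ (c + 1) * h' := by
      have := hff
      rw [hf, map_add, map_mul, map_pow, hst, hσg, hσh] at this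
      -- this : t ^ (ν'+(d+1)) * (t ^ c * g') + t ^ (c+1) * h' = t ^ (c+d+1) * f'
      have e1 : t ^ (c + 1) * (t ^ d * (f' - t ^ ν' * g')) =
          t ^ (c + d + 1) * f' - t ^ (ν' + (d + 1)) * (t ^ c * g') := by ring
      rw [e1, ← this]; ring
    exact (mul_cancel_left_mem_nonZeroDivisors hpow).mp h1
  have hdiff : f' - t ^ ν' * g' ∈ P' ^ (c + 1) :=
    mem_pow_of_pow_mul_mem htw d (c + 1) (hkey ▸ hh'P)
  have htm : t ∈ maximalIdeal S := s_mem_maximalIdeal htw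
  refine ⟨?_, fun hmem' => hm₀ ?_⟩
  · -- membership: `f' = t^ν' g' + (f' - t^ν' g')`
    have : f' = t ^ ν' * g' + (f' - t ^ ν' * g') := by ring
    rw [this]
    exact Submodule.mem_sup.mpr ⟨t ^ ν' * g', Ideal.mul_mem_mul (Ideal.pow_mem_pow htm _) hg'P,
      f' - t ^ ν' * g', hdiff, rfl⟩
  · -- non-membership: a deeper `f'` forces all coefficients of `σG` into `𝔪_S`
    obtain ⟨a, ha, h₃, hh₃, hah⟩ :=
      Submodule.mem_sup.mp (depthIdeal_le_span_pow_mul hfull' c (ν' + 1) hmem')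
    obtain ⟨q, hq, rfl⟩ := Ideal.mem_span_singleton_mul.mp ha
    -- `t^ν' (g' - t q) = h₃ - (f' - t^ν' g') ∈ P'^(c+1)`
    have h2 : t ^ ν' * (g' - t * q) ∈ P' ^ (c + 1) := by
      have : t ^ ν' * (g' - t * q) = h₃ - (f' - t ^ ν' * g') := by
        have e := hah  -- t^(ν'+1) * q + h₃ = f'
        rw [← e]; ring
      rw [this]
      exact sub_mem hh₃ hdiff
    have h3 : g' - t * q ∈ P' ^ (c + 1) := mem_pow_of_pow_mul_mem htw ν' (c + 1) h2
    have h4 : g' ∈ maximalIdeal S * P' ^ c ⊔ P' ^ (c + 1) := by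
      have : g' = t * q + (g' - t * q) := by ring
      rw [this]
      exact Submodule.mem_sup.mpr ⟨t * q, Ideal.mul_mem_mul htm hq, g' - t * q, h3, rfl⟩
    have h5 := coeff_mem_maximalIdeal_of_eval_mem htw hfull' (hG.map σ) h4 m₀
    rw [MvPolynomial.coeff_map] at h5
    -- `σ (G.coeff m₀) ∈ 𝔪_S` and `σ` local ⇒ `G.coeff m₀ ∈ 𝔪_R`
    rw [IsLocalRing.mem_maximalIdeal] at h5 ⊢
    exact fun hu => h5 (hu.map σ)

end DepthAlgebra

end Summit.ResolutionOfSingularities.ResolutionOfSingularities.Theorems.AbsoluteContactClasses
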